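import Literature.Analysis.FluidPDE.PassiveVectorTensorDistorted
import HarnessLib

/-!
# Weak passive solenoidal vectors with a VARIABLE fourth-order viscosity tensor field `𝔹(t, y)`
# (Eulerian, flat constraint): the class `Torus.IsWeakVarTensorPassiveVectorOn`

Analysis/FluidPDE support file (one definition + its kinematic API and bridges; no named facts).

The constant-tensor class `Torus.IsWeakTensorPassiveVectorOn A T 𝔸 b w₀ w` (`PassiveVectorTensor`;
Frisch's anisotropic eddy-viscosity equation (9.57) transported by a further carrier `b`) is the weak
form of `∂ₜw + (b·∇)w + A (w·∇)b + ∇π = 𝓛_𝔸 w`, `∇·w = 0`, with the CONSTANT tensor put on the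
smooth test field through its formal adjoint `viscAdj 𝔸`.  This file types the same class for a
VARIABLE tensor field `𝔹 : ℝ → T^d → Visc4 d` — the divergence-form system
`∂ₜw + (b·∇)w + A (w·∇)b + ∇π = ∇·(𝔹(t,y) ∇w)`, `(∇·(𝔹∇w))_i = Σ_{c,j,e} ∂_c(𝔹_{icje} ∂_e w_j)`,
`∇·w = 0` — VERBATIM the constant-tensor structure with the one substitution
`viscAdj 𝔸 (Ψ t) ↦ viscAdjVar (𝔹 t) (Ψ t)`, the divergence-form TEST operator with `y`-dependent
coefficients of `PassiveVectorTensorDistorted` (`(viscAdjVar 𝔹 Ψ)_j = Σ_{i,c,e} ∂_e(𝔹_{icje} ∂_c Ψ_i)`;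
all derivatives on the test side, as an `L²` weak formulation requires; for a constant field it is
`viscAdj 𝔸`, `viscAdjVar_const`).  This is Giaquinta's variable-coefficient system in divergence
form `−D_α(A^{αβ}_{ij}(x) D_β u^j)` (Ch. III §2 (2.1)–(2.3)) made parabolic and solenoidal, i.e. the
setting of J.-L. Lions' existence theorem for parabolic equations with time-dependent measurable
coefficients (Lions–Magenes I, Chap. 3, §4.3–§4.4), and the passive-VECTOR analogue of
Armstrong–Vicol's DISTORTION-ADAPTED coarse equation `∂ₜT − ∇·((K_m + s_{m−1}) ∇T) + b_{m−1}·∇T = 0`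
(arXiv:2305.05048 §4.1, PDF p. 34: the slowly varying matrix `s_{m−1} = K_m Σ_l ξ̂_{m,l}(∇X_{m−1,l}∘X⁻¹_{m−1,l} − I₂)`
"cannot be neglected in the two-scale ansatz").

Contents: the structure `Torus.IsWeakVarTensorPassiveVectorOn A T 𝔹 b w₀ w`; its kinematic API
(joint measurability, `L^∞_t L²_x` in `eLpNorm` form, `w(t) ∈ L²` a.e., `w ∈ L¹_{t,x}` — verbatim
from the constant class); the bridges `isWeakVarTensorPassiveVectorOn_const_iff` (a CONSTANT field
`𝔹 ≡ 𝔸` gives back `IsWeakTensorPassiveVectorOn A T 𝔸`), `IsWeakTensorPassiveVectorOn.toVarTensor`,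
`IsWeakVarTensorPassiveVectorOn.of_const`, and `IsWeakVarTensorPassiveVectorOn.congr_tensor` (the class
only sees `𝔹 t` for `t ∈ (0,T)` … in fact only through `viscAdjVar (𝔹 t)` on smooth slices, so two
fields that agree pointwise give the same class).  No ellipticity and no regularity of `𝔹` is built in:
consumers add a Legendre–Hadamard window for a constant part plus a small bounded perturbation
(Gårding), and `𝔹(t,·) ∈ C¹` with jointly continuous first derivatives so that `viscAdjVar (𝔹 t) (Ψ t)`
is a genuine continuous space–time field.

Consumer: cell `ad-ideate`, K1L_D `stmt-AnomalousDissipation-27980`, lead memo L9 (Z7 design) §5: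
the ADAPTED COARSE PROBLEM `T_ad` of brick Z7α — Eulerian drift `b_{≤m}`, variable tensor
`J (k̄_m R) Jᵀ ∘ X⁻¹` window by window — and Z7β (two coarse problems with `O(θ)`-close tensors).

## Mathlib / tree search

Tree: `IsWeakTensorPassiveVectorOn` + `viscAdj` (`PassiveVectorTensor`), `viscAdjVar`,
`viscAdjVar_const`, `IsWeakTensorPassiveVectorDistortedOn` (variable tensor `𝔸^{G(t,y)}` but DISTORTED
constraint and Lipschitz tests — not the Eulerian class; `PassiveVectorTensorDistorted`),
`IsSpaceTimeTest.isSmooth_slice` (`TorusSpaceTime`); `rg "viscAdjVar" Literature`: no Eulerian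
variable-tensor class (2026-08-29). Mathlib: measure-theory plumbing only.

## References

* M. Giaquinta, *Multiple integrals in the calculus of variations and nonlinear elliptic systems*
  (Princeton 1983), Ch. III §2 (2.1)–(2.3). [`Giaquinta1983MultipleIntegrals`]
* J.-L. Lions, E. Magenes, *Non-homogeneous boundary value problems and applications* I (Springer
  1972), Chap. 3, §4.3–§4.4 (parabolic problems with time-dependent forms). [`LionsMagenes1972`]
* S. Armstrong, V. Vicol, *Anomalous diffusion by fractal homogenization*, Ann. PDE 11 (2025) /
  arXiv:2305.05048, §4.1 (the equation for `T_{m−1}` with `K_m + s_{m−1}`), PDF p. 34. [`ArmstrongVicol2025`]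
* U. Frisch, *Turbulence* (CUP 1995), §9.6.3 eq. (9.57) p. 233. [`Frisch1995Turbulence`]
* R. J. DiPerna, P.-L. Lions, Invent. Math. 98 (1989), §II.1 (12)–(14). [`DiPernaLions1989`]
-/

noncomputable section

open MeasureTheory Set Filter Function TopologicalSpace
open scoped ENNReal NNReal InnerProductSpace Topology

namespace Literature.Analysis.FluidPDE

namespace Torus

variable {d : Type*} [Fintype d] [DecidableEq d]

/-! ## The class -/

/-- **Weak passive solenoidal vectors with a VARIABLE viscosity tensor field** `𝔹 : ℝ → T^d → Visc4 d`
on `T^d × [0,T)`: the weak form of `∂ₜw + (b·∇)w + A (w·∇)b + ∇π = ∇·(𝔹(t,y)∇w)`, `∇·w = 0`,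
`w(0) = w₀`, along the prescribed divergence-free carrier `b`.  VERBATIM the constant-tensor class
`Torus.IsWeakTensorPassiveVectorOn A T 𝔸 b w₀ w` (measurability of the lifts, `w ∈ L^∞(0,T; L²)`,
`b ∈ L¹(0,T; L²)`, `|b||w| ∈ L¹`, `b(t)`, `w(t)` weakly divergence free a.e., smooth divergence-free
space–time tests vanishing near `t = T`, which eliminate `π`) with the viscous test term
`viscAdj 𝔸 (Ψ t)` replaced by the divergence-form operator with variable coefficients
`viscAdjVar (𝔹 t) (Ψ t)`, `(viscAdjVar 𝔹 Ψ)_j = Σ_{i,c,e} ∂_e(𝔹 i c j e · ∂_c Ψ_i)` (Giaquinta's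
`−D_α(A^{αβ}_{ij}(x) D_β u^j)` on the test side).  For a constant field `𝔹 ≡ 𝔸` this IS the constant
class (`isWeakVarTensorPassiveVectorOn_const_iff`).  No ellipticity or regularity of `𝔹` is built in
(consumers add them; junk reading: for a non-differentiable slice `𝔹 t` the operator `viscAdjVar` takes
the tree's total `partialDeriv`, value `0` off differentiability).  Passive-vector analogue of
Armstrong–Vicol's adapted coarse equation with the slowly varying diffusivity `K_m + s_{m−1}`.
[cite: Giaquinta1983MultipleIntegrals, Ch. III §2 eq. (2.1)-(2.3)] [cite: LionsMagenes1972, Chap. 3 §4.3]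
[cite: ArmstrongVicol2025, §4.1 (s_{m−1}, T_{m−1}), PDF p. 34] [cite: Frisch1995Turbulence, §9.6.3 eq. (9.57) p. 233] -/
structure IsWeakVarTensorPassiveVectorOn (A : ℝ) (T : ℝ) (𝔹 : ℝ → UnitAddTorus d → Visc4 d)
    (b : ℝ → UnitAddTorus d → EuclideanSpace ℝ d) (w₀ : UnitAddTorus d → EuclideanSpace ℝ d)
    (w : ℝ → UnitAddTorus d → EuclideanSpace ℝ d) : Prop where
  /-- `w` is a.e. strongly measurable on `(0,T) × T^d` (through the space–time lift). -/
  aestronglyMeasurable :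
    AEStronglyMeasurable (FunctionSpaces.Torus.stLift w) (volume.restrict (Ioo 0 T ×ˢ univ))
  /-- `b` is a.e. strongly measurable on `(0,T) × T^d` (through the space–time lift). -/
  aestronglyMeasurable_carrier :
    AEStronglyMeasurable (FunctionSpaces.Torus.stLift b) (volume.restrict (Ioo 0 T ×ˢ univ))
  /-- `w ∈ L^∞(0,T; L²(T^d))`: `∫ ‖w(t)‖² ≤ C` for a.e. `t ∈ (0,T)`. -/
  ae_lintegral_sq_le : ∃ C : ℝ≥0, ∀ᵐ t ∂(volume.restrict (Ioo 0 T)), ∫⁻ x, ‖w t x‖ₑ ^ 2 ≤ C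
  /-- `b ∈ L¹(0,T; L²(T^d))`. -/
  lintegral_carrier_lt_top : ∫⁻ t in Ioo 0 T, (∫⁻ x, ‖b t x‖ₑ ^ 2) ^ (1 / 2 : ℝ) < ∞
  /-- `|b| |w| ∈ L¹((0,T) × T^d)` (so that both transport terms make sense). -/
  lintegral_mul_lt_top : ∫⁻ t in Ioo 0 T, ∫⁻ x, ‖b t x‖ₑ * ‖w t x‖ₑ < ∞
  /-- `∇·b(t) = 0` weakly, for a.e. `t ∈ (0,T)`. -/
  ae_isWeaklyDivFree_carrier :
    ∀ᵐ t ∂(volume.restrict (Ioo 0 T)), FunctionSpaces.Torus.IsWeaklyDivFree (b t)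
  /-- `∇·w(t) = 0` weakly, for a.e. `t ∈ (0,T)`. -/
  ae_isWeaklyDivFree :
    ∀ᵐ t ∂(volume.restrict (Ioo 0 T)), FunctionSpaces.Torus.IsWeaklyDivFree (w t)
  /-- The weak formulation with datum, divergence-free vector tests:
  `∫₀ᵀ∫ (⟪w, ∂ₜΨ + (b·∇)Ψ + 𝓛^{𝔹(t),*}Ψ⟫ + A ⟪b, (w·∇)Ψ⟫) + ∫⟪w₀, Ψ(0)⟫ = 0`. -/
  weak_eq : ∀ Ψ : ℝ → UnitAddTorus d → EuclideanSpace ℝ d,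
    FunctionSpaces.Torus.IsSpaceTimeTest T Ψ → (∀ t, FunctionSpaces.Torus.IsDivFree (Ψ t)) →
    (∫ t in Ioo 0 T, ∫ x, (⟪w t x, FunctionSpaces.Torus.timeDeriv Ψ t x +
          FunctionSpaces.Torus.convect (b t) (Ψ t) x + viscAdjVar (𝔹 t) (Ψ t) x⟫_ℝ +
        A * ⟪b t x, FunctionSpaces.Torus.convect (w t) (Ψ t) x⟫_ℝ)) +
      ∫ x, ⟪w₀ x, Ψ 0 x⟫_ℝ = 0

/-! ## Bridges to the constant-tensor class -/

/-- **A constant field `𝔹 ≡ 𝔸` gives back the constant-tensor class**: on smooth test slices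
`viscAdjVar (fun _ => 𝔸) (Ψ t) = viscAdj 𝔸 (Ψ t)` pointwise (`viscAdjVar_const`); every other field
is identical. [cite: Giaquinta1983MultipleIntegrals, Ch. III §2 eq. (2.1)-(2.3)] [cite: Frisch1995Turbulence, §9.6.3 eq. (9.57) p. 233] -/
theorem isWeakVarTensorPassiveVectorOn_const_iff {A T : ℝ} {𝔸 : Visc4 d}
    {b : ℝ → UnitAddTorus d → EuclideanSpace ℝ d} {w₀ : UnitAddTorus d → EuclideanSpace ℝ d}
    {w : ℝ → UnitAddTorus d → EuclideanSpace ℝ d} :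
    IsWeakVarTensorPassiveVectorOn A T (fun _ _ => 𝔸) b w₀ w ↔ IsWeakTensorPassiveVectorOn A T 𝔸 b w₀ w := by
  have key : ∀ Ψ : ℝ → UnitAddTorus d → EuclideanSpace ℝ d,
      FunctionSpaces.Torus.IsSpaceTimeTest T Ψ →
      ∀ t x, viscAdjVar ((fun (_ : ℝ) (_ : UnitAddTorus d) => 𝔸) t) (Ψ t) x = viscAdj 𝔸 (Ψ t) x :=
    fun Ψ hΨ t x => viscAdjVar_const 𝔸 (hΨ.isSmooth_slice t) x
  constructor
  · rintro ⟨h1, h2, h3, h4, h5, h6, h7, h8⟩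
    refine ⟨h1, h2, h3, h4, h5, h6, h7, fun Ψ hΨ hdiv => ?_⟩
    have h := h8 Ψ hΨ hdiv
    simp_rw [key Ψ hΨ] at h
    exact h
  · rintro ⟨h1, h2, h3, h4, h5, h6, h7, h8⟩
    refine ⟨h1, h2, h3, h4, h5, h6, h7, fun Ψ hΨ hdiv => ?_⟩
    simp_rw [key Ψ hΨ]
    exact h8 Ψ hΨ hdiv

/-- A constant-tensor weak solution is a variable-tensor weak solution with the constant field.
[cite: Frisch1995Turbulence, §9.6.3 eq. (9.57) p. 233] -/
theorem IsWeakTensorPassiveVectorOn.toVarTensor {A T : ℝ} {𝔸 : Visc4 d}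
    {b : ℝ → UnitAddTorus d → EuclideanSpace ℝ d} {w₀ : UnitAddTorus d → EuclideanSpace ℝ d}
    {w : ℝ → UnitAddTorus d → EuclideanSpace ℝ d} (h : IsWeakTensorPassiveVectorOn A T 𝔸 b w₀ w) :
    IsWeakVarTensorPassiveVectorOn A T (fun _ _ => 𝔸) b w₀ w :=
  isWeakVarTensorPassiveVectorOn_const_iff.2 h

/-- A variable-tensor weak solution with a constant field is a constant-tensor weak solution.
[cite: Frisch1995Turbulence, §9.6.3 eq. (9.57) p. 233] -/
theorem IsWeakVarTensorPassiveVectorOn.of_const {A T : ℝ} {𝔸 : Visc4 d}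
    {b : ℝ → UnitAddTorus d → EuclideanSpace ℝ d} {w₀ : UnitAddTorus d → EuclideanSpace ℝ d}
    {w : ℝ → UnitAddTorus d → EuclideanSpace ℝ d}
    (h : IsWeakVarTensorPassiveVectorOn A T (fun _ _ => 𝔸) b w₀ w) :
    IsWeakTensorPassiveVectorOn A T 𝔸 b w₀ w :=
  isWeakVarTensorPassiveVectorOn_const_iff.1 h

namespace IsWeakVarTensorPassiveVectorOn

variable {A T : ℝ} {𝔹 𝔹' : ℝ → UnitAddTorus d → Visc4 d} {b w : ℝ → UnitAddTorus d → EuclideanSpace ℝ d}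
  {w₀ : UnitAddTorus d → EuclideanSpace ℝ d}

/-- **The class depends on the tensor field only through its slices on `[0,T)`**: if `𝔹' t = 𝔹 t`
for every `t ∈ [0,T)`, the two classes coincide (tests vanish for `t ≥ T' `, some `T' < T`; the weak
integrand is integrated over `(0,T)` only). [cite: LionsMagenes1972, Chap. 3 §4.3] -/
theorem congr_tensor (h : IsWeakVarTensorPassiveVectorOn A T 𝔹 b w₀ w)
    (h𝔹 : ∀ t ∈ Ioo 0 T, 𝔹' t = 𝔹 t) : IsWeakVarTensorPassiveVectorOn A T 𝔹' b w₀ w where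
  aestronglyMeasurable := h.aestronglyMeasurable
  aestronglyMeasurable_carrier := h.aestronglyMeasurable_carrier
  ae_lintegral_sq_le := h.ae_lintegral_sq_le
  lintegral_carrier_lt_top := h.lintegral_carrier_lt_top
  lintegral_mul_lt_top := h.lintegral_mul_lt_top
  ae_isWeaklyDivFree_carrier := h.ae_isWeaklyDivFree_carrier
  ae_isWeaklyDivFree := h.ae_isWeaklyDivFree
  weak_eq Ψ hΨ hdiv := by
    have key := h.weak_eq Ψ hΨ hdiv
    have e : ∫ t in Ioo 0 T, ∫ x, (⟪w t x, FunctionSpaces.Torus.timeDeriv Ψ t x +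
          FunctionSpaces.Torus.convect (b t) (Ψ t) x + viscAdjVar (𝔹' t) (Ψ t) x⟫_ℝ +
        A * ⟪b t x, FunctionSpaces.Torus.convect (w t) (Ψ t) x⟫_ℝ) =
        ∫ t in Ioo 0 T, ∫ x, (⟪w t x, FunctionSpaces.Torus.timeDeriv Ψ t x +
          FunctionSpaces.Torus.convect (b t) (Ψ t) x + viscAdjVar (𝔹 t) (Ψ t) x⟫_ℝ +
        A * ⟪b t x, FunctionSpaces.Torus.convect (w t) (Ψ t) x⟫_ℝ) := by
      refine setIntegral_congr_fun measurableSet_Ioo fun t ht => ?_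
      simp only [h𝔹 t ht]
    rw [e]
    exact key

/-! ## Kinematic API (verbatim from the constant class) -/

/-- Joint measurability of `w` on `(0,T) × T^d`. [cite: DiPernaLions1989, §II.1 (12)–(14)] -/
theorem aestronglyMeasurable_uncurry (h : IsWeakVarTensorPassiveVectorOn A T 𝔹 b w₀ w) :
    AEStronglyMeasurable (uncurry w) (((volume : Measure ℝ).restrict (Ioo 0 T)).prod volume) := by
  rw [← volume_restrict_prod_eq]
  exact FunctionSpaces.Torus.aestronglyMeasurable_uncurry_of_stLift_restrict h.aestronglyMeasurable

/-- Joint measurability of the carrier `b` on `(0,T) × T^d`. [cite: DiPernaLions1989, §II.1 (12)–(14)] -/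
theorem aestronglyMeasurable_uncurry_carrier (h : IsWeakVarTensorPassiveVectorOn A T 𝔹 b w₀ w) :
    AEStronglyMeasurable (uncurry b) (((volume : Measure ℝ).restrict (Ioo 0 T)).prod volume) := by
  rw [← volume_restrict_prod_eq]
  exact FunctionSpaces.Torus.aestronglyMeasurable_uncurry_of_stLift_restrict h.aestronglyMeasurable_carrier

/-- Slices are measurable for a.e. `t`. [cite: DiPernaLions1989, §II.1 (12)–(14)] -/
theorem ae_aestronglyMeasurable_slice (h : IsWeakVarTensorPassiveVectorOn A T 𝔹 b w₀ w) :
    ∀ᵐ t ∂(volume.restrict (Ioo 0 T)),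
      AEStronglyMeasurable (w t) volume ∧ AEStronglyMeasurable (b t) volume := by
  filter_upwards [h.aestronglyMeasurable_uncurry.prodMk_left,
    h.aestronglyMeasurable_uncurry_carrier.prodMk_left] with t h1 h2
  exact ⟨h1, h2⟩

/-- The `L^∞_t L²_x` bound in `eLpNorm` form. [cite: DiPernaLions1989, §II.1 (12)–(14)] -/
theorem exists_eLpNorm_le (h : IsWeakVarTensorPassiveVectorOn A T 𝔹 b w₀ w) :
    ∃ C : ℝ≥0, ∀ᵐ t ∂(volume.restrict (Ioo 0 T)), eLpNorm (w t) 2 volume ≤ C := by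
  obtain ⟨C, hC⟩ := h.ae_lintegral_sq_le
  refine ⟨NNReal.sqrt C, ?_⟩
  filter_upwards [hC] with t ht
  rw [eLpNorm_eq_lintegral_rpow_enorm_toReal two_ne_zero ENNReal.ofNat_ne_top, ENNReal.toReal_ofNat]
  have h2 : ∫⁻ x, ‖w t x‖ₑ ^ (2 : ℝ) = ∫⁻ x, ‖w t x‖ₑ ^ 2 := by
    refine lintegral_congr fun x => ?_
    rw [← ENNReal.rpow_two]
  rw [h2]
  calc (∫⁻ x, ‖w t x‖ₑ ^ 2) ^ (1 / (2 : ℝ)) ≤ (C : ℝ≥0∞) ^ (1 / (2 : ℝ)) := by gcongr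
    _ = NNReal.sqrt C := by
        rw [← ENNReal.coe_rpow_of_nonneg _ (by norm_num), ← NNReal.sqrt_eq_rpow]

/-- For a.e. `t ∈ (0,T)`, `w t ∈ L²(T^d)`. [cite: DiPernaLions1989, §II.1 (12)–(14)] -/
theorem ae_memLp_two (h : IsWeakVarTensorPassiveVectorOn A T 𝔹 b w₀ w) :
    ∀ᵐ t ∂(volume.restrict (Ioo 0 T)), MemLp (w t) 2 volume := by
  obtain ⟨C, hC⟩ := h.exists_eLpNorm_le
  filter_upwards [hC, h.aestronglyMeasurable_uncurry.prodMk_left] with t ht hm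
  exact ⟨hm, ht.trans_lt ENNReal.coe_lt_top⟩

/-- `w ∈ L¹((0,T) × T^d)`. [cite: DiPernaLions1989, §II.1 (12)–(14)] -/
theorem integrable_uncurry (h : IsWeakVarTensorPassiveVectorOn A T 𝔹 b w₀ w) :
    Integrable (uncurry w) (((volume : Measure ℝ).restrict (Ioo 0 T)).prod volume) := by
  obtain ⟨C, hC⟩ := h.exists_eLpNorm_le
  refine ⟨h.aestronglyMeasurable_uncurry, ?_⟩
  rw [hasFiniteIntegral_iff_enorm, lintegral_prod _ h.aestronglyMeasurable_uncurry.enorm]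
  calc ∫⁻ t in Ioo 0 T, ∫⁻ x, ‖uncurry w (t, x)‖ₑ
      ≤ ∫⁻ _ in Ioo 0 T, (C : ℝ≥0∞) := by
        refine lintegral_mono_ae ?_
        filter_upwards [hC, h.aestronglyMeasurable_uncurry.prodMk_left] with t ht hm
        calc ∫⁻ x, ‖uncurry w (t, x)‖ₑ = eLpNorm (w t) 1 volume := by
              rw [eLpNorm_one_eq_lintegral_enorm]; rfl
          _ ≤ eLpNorm (w t) 2 volume := eLpNorm_le_eLpNorm_of_exponent_le (by norm_num) hm
          _ ≤ C := ht
    _ < ⊤ := by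
        rw [setLIntegral_const]
        exact ENNReal.mul_lt_top ENNReal.coe_lt_top measure_Ioo_lt_top

end IsWeakVarTensorPassiveVectorOn

end Torus

end Literature.Analysis.FluidPDE

end
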